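import Literature.MathematicalPhysics.QuantumFieldTheory.QCDPhaseQuenched

/-!
# Crux `ChiralMobilityGap` (stmt-QuantumFields-17497), line `Sketch`, stub D `stub_detTwo`:
# the two-flavour Wilson determinant of a degenerate doublet is non-negative

For a mass-degenerate doublet `(t, t)` the `N_f = 2` Wilson determinant is
`det D = det D_W(t) · det D_W(t)` (`det_diracMatrix`, block-diagonal in flavour), and `det D_W(t)` is
REAL by `γ₅`-hermiticity (`fermionDet_wilsonDirac_im_holds`, Montvay–Münster (5.16)). Hence
`det D = (Re det D_W)² ≥ 0`, i.e. the SIGNED weight coincides with the phase-quenched weight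
`|det D|`: `det D = (‖det D‖ : ℂ)`.
-/

noncomputable section

namespace Summit.QuantumFields.QCD.Theorems.ChiralMobilityGapSketch

open scoped BigOperators
open MeasureTheory
open Literature.MathematicalPhysics.QuantumFieldTheory Literature.MathematicalPhysics.QuantumLattice
  Literature.Probability.LatticeModels

/-- STUB D (`N_f = 2`, degenerate doublet). **The two-flavour Wilson determinant of a mass-degenerate
doublet is non-negative**: for bare masses `(t, t)` on the four-torus of side `S`,
`det D(U) = (‖det D(U)‖ : ℂ)`, because `det D = det D_W(t) · det D_W(t)` (`det_diracMatrix`) with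
`det D_W(t)` real (`γ₅`-hermiticity, `fermionDet_wilsonDirac_im_holds`), so `det D = (Re det D_W)² ≥ 0`. -/
theorem stub_detTwo :
    ∀ {S : ℕ} [NeZero S] (U : GaugeConfig 4 S SU3) (t : ℝ),
      (diracMatrix U (fun _ : Fin 2 => t)).det = ((‖(diracMatrix U (fun _ : Fin 2 => t)).det‖ : ℝ) : ℂ) := by
  intro S _ U t
  -- the one-flavour Wilson determinant is real
  have him : (fermionDet (wilsonDirac (fundamentalRep (Fin 3)) U t 1)).im = 0 :=
    fermionDet_wilsonDirac_im_holds (L := S) (fundamentalRep (Fin 3))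
      (fun g => fundamentalRep_mem_unitaryGroup g) U t 1
  -- `det D = d * d` (block-diagonal in the two flavours)
  simp only [det_diracMatrix, Fin.prod_univ_two]
  generalize fermionDet (wilsonDirac (fundamentalRep (Fin 3)) U t 1) = d at him ⊢
  -- `d = Re d`, so `d * d = (Re d)² = |(Re d)²| = ‖d * d‖`
  obtain ⟨x, rfl⟩ : ∃ x : ℝ, (x : ℂ) = d := ⟨d.re, Complex.ext (by simp) (by simp [him])⟩
  rw [← Complex.ofReal_mul, Complex.norm_real, Real.norm_eq_abs, abs_mul_self]

end Summit.QuantumFields.QCD.Theorems.ChiralMobilityGapSketch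

end
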